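/-
Copyright (c) 2026 the pub-hodgecm-mathlib formalisation cell (harness21).  Prover seat hodgecm-mathlib-LH4-p06 (g0): unit U2H_HSide of the «(D-RAM) FOUR-FRAME» road,
TIER-2 brick «Δ1» of the row-(1) matching lemma behind `stub_U2H_hSideAnchorRows_unit0` (design `U2H-ED4-DRAFT-DESIGN.v1` §2 (ii)–(iii)).  2026-09-03.
-/
import Literature.NumberTheory.Rogawski1990.FinExplicitTransferFactorDeepTauAnyPlacePairs   -- ★ T5-u-ANY-PLACE germ form `exists_nhds_one_forall_finExplicitDelta_eq_hilbertSymbol_mul_anyPlace` (+ `…DeepTauAnyPlace`: `exists_units_toPlace_eq_symmDisc_of_deep_anyPlace`)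
import Literature.NumberTheory.Rogawski1990.FinExplicitTransferFactorInertExponent          -- ★ `eval_finCharpolyTwo_finGammaTwo_apply_eq`, `map_finCharpolyTwo_eq_mul_of_isRoot`
import Summits.HodgeConjecture.HodgeConjecture.Theorems.F0P3cDyRamCayleySignFPartProd      -- ★ p855070 (c″) `hilbertSymbol_symmDisc_eq_normSign_fPartProd`
import Summits.HodgeConjecture.HodgeConjecture.Theorems.F0P3cDyRamTransferFactorTypeOne   -- ★ p854932 (LH4-p08): `finKappaAt_frame_eq` (κ on the literals), `delta_frame_eq_mul_kappaChar` (the relative factor IS κ₂)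
import HarnessLib

/-!
# Crux `H413`, line LH4 «(D-RAM) FOUR-FRAME» road — unit U2H_HSide (ii-H), TIER 2, brick «Δ1»: THE BASE TRANSFER FACTOR ON ROW-(1) DATA IN SHEET CURRENCY,
# `Δ‴_v[μ](γ_H, γ′) = normSign σ_w (fPartProd δ (a, b, 1) 2) · q_v^{−m} · κ_v(γ_H, γ′)` near `1` (germ form, every non-split place)

Cell `hodgecm-mathlib` (D-0151), FLOOR 0, crux item H413 = `stmt-HodgeConjecture-24833`, route of record `HCCMUnconditional`; squad F0∕P3c∕LH4; tier-1 module
`Cruxes/H413/Lines/F0_P3c_DyRamFourFrame_U2H_HSide.lean`, export `stub_U2H_hSideAnchorRows_unit0` (seat LH4-p06 (g0); U2H ED. 4 RESHAPE (R-16) + SPLIT).  THEOREMS ONLY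
(no `def`, no instance, no notation, no `sorry`, no named fact, default heartbeats); lane `--supports stmt-HodgeConjecture-24833` (count-neutral).

WHAT THIS BRICK DOES.  (D-H) row (1) (★ №2c∕№2c-R `HSideAnchorRows(S)`) multiplies the BASE transfer factor `Δ‴_v[μ](γ_H, t_{b₀})` of a type-(1) `γ_H` near `1` — with the
four-frame data `(a, b, z)`: canonical roots `a, b` (`a·σa = b·σb = 1`), `z = γ₂(γ_H)_w`, `z a², z b²` the two roots of `χ_g` at `w` — by the sheet's sign
`baseSign 2 · normSign σ (fPartProd δ (a,b,1) 2)`.  ★ T5-u-ANY-PLACE (`FinExplicitTransferFactorDeepTauAnyPlacePairs`, `h2` deleted) evaluates `Δ‴_v(γ_H, γ′)` on matched pairs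
near `1` as `(β, θ)_v · q_v^{−m} · κ_v(γ_H, γ′)` with `β` the symmetrised discriminant and `|χ_g(u)_w| = |ι_w ϖ_v|^m`; ★ p855070 (c″) reads `(β, θ)_v = normSign σ (fPartProd δ
(a,b,1) 2)` at the eigen-triple `(z a², z b², z)`.  This file GLUES the two on the row's own binders: from the two `IsRoot` clauses `χ_g(z)_w = (z − z a²)(z − z b²)` and
`det g_w = z² a² b²` (§1), the symmetrised discriminant takes (c″)'s shape, its existence in `L⁺_v` is ★ `exists_units_toPlace_eq_symmDisc_of_deep_anyPlace` on the deep
neighbourhood, and so (§2, HEAD) near `1`:  `Δ‴_v[μ](γ_H, γ′) = normSign σ (fPartProd δ (a,b,1) 2) · (q_v^m)⁻¹ · κ_v(γ_H, γ′)` for every matched `γ′`, where `m` is the caller's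
depth token `|(z − z a²)(z − z b²)|_w = |ι_w ϖ_v|_w^m` (on the row: `m = (n₁ + n₂)∕2`).  Remaining for the row-(1) matching lemma (design §2): the slot∕κ lemmas (S)(K) from U1,
`μ_w(z) = 1` near `1` is NOT needed (T5-u carries no `μ_v(u)` factor), the token `m = (n₁+n₂)∕2` from `IsElementDatum`, the depth of `a, b` from `V`, and the `ampl` arithmetic.

* §1 `eval_finCharpolyTwo_apply_eq_of_isRoot_map` (`χ_g(z)_w = (z − r₁)(z − r₂)`), `det_map_eq_mul_of_isRoot_map` (`det g_w = r₁ r₂`) — from the row's two `IsRoot` binders.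
* §2 HEAD **`exists_nhds_one_forall_finExplicitDelta_eq_normSign_fPartProd_mul`**.

HONEST LABEL.  Count-neutral; nothing printed is asserted; the verdict of record for (D-RAM) stays PRINT [LanglandsShelstad1989 Thm. p. 484 ∕ Rogawski1990 Prop. 4.9.1 (a)]
∕ XL; `HC_CM` is proved only modulo the 7 printed citations (2 remaining: hLiu418 = `stmt-HodgeConjecture-24832`, h413 = `stmt-HodgeConjecture-24833`) until rung 0 closes.

## References
* [Rogawski1990] J. D. Rogawski, *Automorphic Representations of Unitary Groups in Three Variables*, Ann. of Math. Stud. 123 (1990): §4.9 p. 55 (`Δ_{G∕H} = τ·D`),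
  Lemma 4.9.3 (4.9.2) p. 56, Prop. 8.1.3 p. 116.
* [LabesseLanglands1979] J.-P. Labesse, R. P. Langlands, *L-indistinguishability for SL(2)*, Canad. J. Math. 31 (1979): §2 (2.1)–(2.2).
* [LanglandsShelstad1987] R. P. Langlands, D. Shelstad, *On the definition of transfer factors*, Math. Ann. 278 (1987), §3 (`Δ_{III₂}·Δ_{IV}` near the identity).
-/

set_option autoImplicit false

noncomputable section

namespace Summit.HodgeConjecture.HodgeConjecture.Cruxes.H413.F0P3cDyRamRowOneDeltaBaseValue

open NumberField IsDedekindDomain Filter Topology Polynomial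
open Literature.NumberTheory.Automorphic Literature.NumberTheory.Automorphic.UnitaryGroup Literature.NumberTheory.GaloisRepresentations
open Literature.NumberTheory.QuadraticForms Literature.NumberTheory.Rogawski1990
open Literature.NumberTheory.Automorphic.UnitaryThreeFourFrame
open Summit.HodgeConjecture.HodgeConjecture.Cruxes.H413.F0P3cDyRamCayleySignFPartProd
open scoped Valued WithZero Matrix MatrixGroups

variable (L : Type) [Field L] [NumberField L] [IsCMField L] (v : HeightOneSpectrum (𝓞 ↥(maximalRealSubfield L)))
  (w : PlacesOver L v) (hw : IsCMField.complexConj L • w.1 = w.1)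

/-! ## §1 From the row's two `IsRoot` binders: `χ_g(z)_w = (z − r₁)(z − r₂)` and `det g_w = r₁ r₂` -/

section Roots

variable (γH : (cmDatum L 2 (Matrix.of fun i j : Fin 2 => if i.val + j.val + 1 = 2 then (1 : L) else 0)).Local v ×
    (cmDatum L 1 (Matrix.of fun i j : Fin 1 => if i.val + j.val + 1 = 1 then (1 : L) else 0)).Local v)

/-- The row's `IsRoot` binder (on the characteristic polynomial of the `w`-component matrix `g_w`) in ★'s currency (on `χ_g` mapped to `w`): `χ_{g_w} = (χ_g)_w`
(`Matrix.charpoly_map`). [cite: Rogawski1990, §4.9 p. 55] -/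
theorem isRoot_map_finCharpolyTwo_of_isRoot_charpoly_map {r : w.1.adicCompletion L}
    (hr : ((((γH).1.val : GL (Fin 2) (UnitaryGroup.LocalRing L v)).val.map
      (Pi.evalRingHom (fun w' : UnitaryGroup.PlacesOver L v => w'.1.adicCompletion L) w))).charpoly.IsRoot r) :
    ((finCharpolyTwo L v γH).map (Pi.evalRingHom (fun w' : UnitaryGroup.PlacesOver L v => w'.1.adicCompletion L) w)).IsRoot r := by
  unfold finCharpolyTwo
  rwa [← Matrix.charpoly_map]

/-- **`χ_g(z)_w = (z − r₁)(z − r₂)`** for two distinct roots `r₁ ≠ r₂` of `χ_{g_w}` (`z = γ₂(γ_H)_w`; ★ `eval_finCharpolyTwo_finGammaTwo_apply_eq`). [cite: Rogawski1990, §4.9 p. 55] -/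
theorem eval_finCharpolyTwo_apply_eq_of_isRoot_map {r₁ r₂ : w.1.adicCompletion L}
    (h₁ : ((((γH).1.val : GL (Fin 2) (UnitaryGroup.LocalRing L v)).val.map
      (Pi.evalRingHom (fun w' : UnitaryGroup.PlacesOver L v => w'.1.adicCompletion L) w))).charpoly.IsRoot r₁)
    (h₂ : ((((γH).1.val : GL (Fin 2) (UnitaryGroup.LocalRing L v)).val.map
      (Pi.evalRingHom (fun w' : UnitaryGroup.PlacesOver L v => w'.1.adicCompletion L) w))).charpoly.IsRoot r₂) (h12 : r₁ ≠ r₂) :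
    ((finCharpolyTwo L v γH).eval (finGammaTwo L v γH)) w = (finGammaTwo L v γH w - r₁) * (finGammaTwo L v γH w - r₂) :=
  eval_finCharpolyTwo_finGammaTwo_apply_eq L v w γH (isRoot_map_finCharpolyTwo_of_isRoot_charpoly_map L v w γH h₁)
    (isRoot_map_finCharpolyTwo_of_isRoot_charpoly_map L v w γH h₂) h12

/-- **`det g_w = r₁ · r₂`** for two distinct roots of `χ_{g_w}` (a `2 × 2` determinant is the constant coefficient of the characteristic polynomial, which factors as
`(X − r₁)(X − r₂)` — ★ `map_finCharpolyTwo_eq_mul_of_isRoot`). [cite: Rogawski1990, §4.9 p. 55] -/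
theorem det_map_eq_mul_of_isRoot_map {r₁ r₂ : w.1.adicCompletion L}
    (h₁ : ((((γH).1.val : GL (Fin 2) (UnitaryGroup.LocalRing L v)).val.map
      (Pi.evalRingHom (fun w' : UnitaryGroup.PlacesOver L v => w'.1.adicCompletion L) w))).charpoly.IsRoot r₁)
    (h₂ : ((((γH).1.val : GL (Fin 2) (UnitaryGroup.LocalRing L v)).val.map
      (Pi.evalRingHom (fun w' : UnitaryGroup.PlacesOver L v => w'.1.adicCompletion L) w))).charpoly.IsRoot r₂) (h12 : r₁ ≠ r₂) :
    ((γH.1.val.val : Matrix (Fin 2) (Fin 2) (LocalRing L v)).map (Pi.evalRingHom (fun w' : PlacesOver L v => w'.1.adicCompletion L) w)).det = r₁ * r₂ := by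
  have hfac := map_finCharpolyTwo_eq_mul_of_isRoot L v w γH (isRoot_map_finCharpolyTwo_of_isRoot_charpoly_map L v w γH h₁)
    (isRoot_map_finCharpolyTwo_of_isRoot_charpoly_map L v w γH h₂) h12
  have hchar : ((γH.1.val.val : Matrix (Fin 2) (Fin 2) (LocalRing L v)).map (Pi.evalRingHom (fun w' : PlacesOver L v => w'.1.adicCompletion L) w)).charpoly =
      (X - C r₁) * (X - C r₂) := by
    rw [Matrix.charpoly_map, ← hfac]; rfl
  rw [Matrix.det_eq_sign_charpoly_coeff, hchar, Polynomial.coeff_zero_eq_eval_zero]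
  simp

end Roots

/-! ## §2 HEAD: the base transfer factor on row-(1) data, germ form -/

section Head

variable (μ : HeckeCharacter L)
  (hμω : ∀ x : ideleGroup ↥(maximalRealSubfield L), μ (AdeleRing.ideleBaseChange ↥(maximalRealSubfield L) L x) = quadraticHeckeCharCM L x)

include hw hμω in
/-- **HEAD «Δ1» — THE BASE TRANSFER FACTOR ON ROW-(1) DATA IN SHEET CURRENCY (germ form, every non-split place, dyadic included).**  For `μ` with print's guard
`μ|_{𝕀_{L⁺}} = ω_{L∕L⁺}` there is `V ∈ 𝓝 (1 : H_v)` such that for every `γ_H ∈ V` and all data `(δ, a, b, z, m)` with `σδ = −δ ≠ 0`, `a·σa = b·σb = 1`, `|a − 1|², |b − 1|² < |8|`,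
`z = γ₂(γ_H)_w`, `z·a·a ≠ z·b·b` the two roots of `χ_{g_w}` (the row's `IsRoot` binders) and depth token `|(z − z a a)(z − z b b)|_w = |ι_w ϖ_v|_w^m`, and every `γ′` MATCHED
with `γ_H` (★ `IsLocalNormPair`):  `Δ‴_v[μ](γ_H, γ′) = normSign σ_w (fPartProd δ (a, b, 1) 2) · (q_v^m)⁻¹ · κ_v(γ_H, γ′)` (`q_v = #k_v`).
Proof: intersect ★ T5-u-ANY-PLACE's germ neighbourhood with the `|2 ι_w ϖ_v|`-deep one (★ `eventually_nhds_one_valued_sub_one_le`); there the symmetrised discriminant exists in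
`L⁺_v` (★ `exists_units_toPlace_eq_symmDisc_of_deep_anyPlace`), has (c″)'s shape by §1, and (c″) ★ p855070 converts `(β, θ)_v`.
[cite: Rogawski1990, §4.9 p. 55; Lemma 4.9.3 (4.9.2) p. 56; Prop. 8.1.3 p. 116] [cite: LabesseLanglands1979, §2 (2.1)–(2.2)] [cite: LanglandsShelstad1987, §3] -/
theorem exists_nhds_one_forall_finExplicitDelta_eq_normSign_fPartProd_mul (H' : Matrix (Fin 3) (Fin 3) L) :
    ∃ V ∈ 𝓝 (1 : (cmDatum L 2 (Matrix.of fun i j : Fin 2 => if i.val + j.val + 1 = 2 then (1 : L) else 0)).Local v ×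
        (cmDatum L 1 (Matrix.of fun i j : Fin 1 => if i.val + j.val + 1 = 1 then (1 : L) else 0)).Local v),
      ∀ γH ∈ V, ∀ (δ a b z : w.1.adicCompletion L) (m : ℕ) (γ' : (cmDatum L 3 H').Local v),
        galAdicCompletionMap (L := L) (IsCMField.complexConj L) hw δ = -δ → δ ≠ 0 →
        a * galAdicCompletionMap (L := L) (IsCMField.complexConj L) hw a = 1 → b * galAdicCompletionMap (L := L) (IsCMField.complexConj L) hw b = 1 →
        Valued.v (a - 1) * Valued.v (a - 1) < Valued.v (8 : w.1.adicCompletion L) →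
        Valued.v (b - 1) * Valued.v (b - 1) < Valued.v (8 : w.1.adicCompletion L) →
        z = finGammaTwo L v γH w →
        ((((γH).1.val : GL (Fin 2) (UnitaryGroup.LocalRing L v)).val.map
          (Pi.evalRingHom (fun w' : UnitaryGroup.PlacesOver L v => w'.1.adicCompletion L) w))).charpoly.IsRoot (z * (a * a)) →
        ((((γH).1.val : GL (Fin 2) (UnitaryGroup.LocalRing L v)).val.map
          (Pi.evalRingHom (fun w' : UnitaryGroup.PlacesOver L v => w'.1.adicCompletion L) w))).charpoly.IsRoot (z * (b * b)) →
        z * (a * a) ≠ z * (b * b) →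
        Valued.v ((z - z * (a * a)) * (z - z * (b * b))) =
          Valued.v ((toPlace v w (HeckeCharacter.uniformizer ↥(maximalRealSubfield L) v : v.adicCompletion ↥(maximalRealSubfield L))) ^ m) →
        IsLocalNormPair L H' v γH γ' →
        finExplicitDelta L v H' γH μ γ' =
          ((normSign (galAdicCompletionMap (L := L) (IsCMField.complexConj L) hw) (fPartProd δ ![a, b, 1] 2) : ℤ) : ℂ) *
            (((Nat.card (𝓞 ↥(maximalRealSubfield L) ⧸ v.asIdeal) : ℂ) ^ m))⁻¹ * ((finKappaAt L v H' γH γ' : ℤ) : ℂ) := by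
  -- the two neighbourhoods: ★ T5-u-ANY-PLACE's germ one, and the `|2 ι_w ϖ_v|`-deep one
  obtain ⟨V₁, hV₁, h₁⟩ := exists_nhds_one_forall_finExplicitDelta_eq_hilbertSymbol_mul_anyPlace L v w hw μ hμω H'
  set ϖF : w.1.adicCompletion L :=
    toPlace v w (HeckeCharacter.uniformizer ↥(maximalRealSubfield L) v : v.adicCompletion ↥(maximalRealSubfield L)) with hϖFdef
  have h20 : (2 : w.1.adicCompletion L) ≠ 0 := two_ne_zero_adicCompletion L v w
  have hϖF0 : ϖF ≠ 0 := toPlace_heckeUniformizer_ne_zero L v w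
  have hc0 : (2 : w.1.adicCompletion L) * ϖF ^ 1 ≠ 0 := mul_ne_zero h20 (pow_ne_zero _ hϖF0)
  obtain ⟨V₂, hV₂, h₂⟩ := (eventually_nhds_one_valued_sub_one_le L v w hc0).exists_mem
  refine ⟨V₁ ∩ V₂, Filter.inter_mem hV₁ hV₂, ?_⟩
  intro γH hγ δ a b z m γ' hδ hδ0 ha hb ha8 hb8 hz hra hrb hab htok hpair
  obtain ⟨hud, hdd⟩ := h₂ γH hγ.2
  rw [map_mul] at hud hdd
  -- §1: `χ_g(z)_w` and `det g_w` from the two roots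
  have hχ : ((finCharpolyTwo L v γH).eval (finGammaTwo L v γH)) w = (z - z * (a * a)) * (z - z * (b * b)) := by
    rw [eval_finCharpolyTwo_apply_eq_of_isRoot_map L v w γH hra hrb hab, ← hz]
  have hdet : ((γH.1.val.val : Matrix (Fin 2) (Fin 2) (LocalRing L v)).map
      (Pi.evalRingHom (fun w' : PlacesOver L v => w'.1.adicCompletion L) w)).det = z * (a * a) * (z * (b * b)) :=
    det_map_eq_mul_of_isRoot_map L v w γH hra hrb hab
  -- `z ≠ 0` (it is `|2 ι ϖ|`-close to `1`) and `χ_g(z)_w ≠ 0`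
  have hz0 : z ≠ 0 := by
    intro h0
    rw [← hz, h0, zero_sub, Valuation.map_neg, Valuation.map_one] at hud
    have hlt : Valued.v (2 : w.1.adicCompletion L) * Valued.v (ϖF ^ 1) < 1 :=
      lt_of_le_of_lt (mul_le_of_le_one_left' (valued_two_le_one L v w)) (valued_toPlace_heckeUniformizer_pow_lt_one L v w (le_refl 1))
    exact (lt_irrefl _) (lt_of_le_of_lt hud hlt)
  have hχ0 : ((finCharpolyTwo L v γH).eval (finGammaTwo L v γH)) w ≠ 0 := by
    rw [hχ]
    intro h0
    rw [h0, map_zero] at htok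
    exact pow_ne_zero m hϖF0 ((Valuation.zero_iff _).1 htok.symm)
  -- the symmetrised discriminant exists in `L⁺_v` and has (c″)'s shape
  obtain ⟨β, hβ⟩ := exists_units_toPlace_eq_symmDisc_of_deep_anyPlace L v w hw (le_refl 1) γH hχ0 hud hdd
  have hβ' : toPlace v w (β : v.adicCompletion ↥(maximalRealSubfield L)) =
      -(((z - z * (a * a)) * (z - z * (b * b))) * (z ^ 2 + z ^ 2 * ((a * a) * (b * b)))) / (2 * z ^ 2 * (z ^ 2 * ((a * a) * (b * b)))) := by
    rw [hβ, hχ, hdet, ← hz]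
    ring
  have hsymm := hilbertSymbol_symmDisc_eq_normSign_fPartProd L v w hw hδ hδ0 hz0 ha hb ha8 hb8 β.ne_zero hβ'
  -- ★ T5-u-ANY-PLACE on the matched pair, then (c″)
  have htok' : Valued.v (((finCharpolyTwo L v γH).eval (finGammaTwo L v γH)) w) = Valued.v (ϖF ^ m) := by rw [hχ]; exact htok
  rw [h₁ γH hγ.1 m γ' htok' β hβ hpair, hsymm]

end Head

/-! ## §3 ROW (1)'s RIGHT-HAND SIDE COLLAPSES AT THE SLOT: `Δ‴(γ_H, t_0)·C·(baseSign i·ω(fPartProd δ l i))·x = C·q_v^{−m}·x` -/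

section Collapse

/-- `ω(x)² = 1` (`normSign` takes the values `±1`). [cite: Rogawski1990, §4.9 p. 55] -/
theorem normSign_mul_self {K : Type} [Field K] (σ : K →+* K) (x : K) : normSign σ x * normSign σ x = 1 := by
  unfold normSign
  split_ifs <;> norm_num

/-- **THE SLOT LEMMA (S)**: if the relative transfer factor on the four literals is `κ_i` (the row's antecedent `Δ‴(γ_H, t_b) = Δ‴(γ_H, t_0)·κ_i(b)` for all `b`) then `i = 2` —
because it IS `κ₂ = ε₁ε₂` (★ p854932 `delta_frame_eq_mul_kappaChar`) and `Δ‴(γ_H, t_0) ≠ 0` (★ `finExplicitDelta_ne_zero_of_isUnit`), while `κ₀(1) ≠ κ₂(1)` and `κ₁(2) ≠ κ₂(2)`.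
Stated over an abstract non-zero base value `D` and the two sign functions, pure `Fin` arithmetic. [cite: Rogawski1990, §4.9 p. 55] -/
theorem slot_eq_two_of_kappaChar_eq {D : ℂ} (hD : D ≠ 0) {i : Fin 3} (h : ∀ b : Fin 4, D * (kappaChar i b : ℂ) = D * (kappaChar 2 b : ℂ)) : i = 2 := by
  have h' : ∀ b : Fin 4, kappaChar i b = kappaChar 2 b := fun b => by exact_mod_cast mul_left_cancel₀ hD (h b)
  fin_cases i
  · exact absurd (h' 1) (by decide)
  · exact absurd (h' 2) (by decide)
  · rfl

variable (μ : HeckeCharacter L)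
  (hμω : ∀ x : ideleGroup ↥(maximalRealSubfield L), μ (AdeleRing.ideleBaseChange ↥(maximalRealSubfield L) L x) = quadraticHeckeCharCM L x)

include hw hμω in
/-- **HEAD «Δ2» — ROW (1)'s RIGHT-HAND SIDE COLLAPSES AT THE SLOT (germ form).**  There is `V ∈ 𝓝 (1 : H_v)` such that for every `G`-regular `γ_H ∈ V` and every tuple of
(D-H) row-(1) data over it — four-frame family `f`, canonical roots `a, b` (norm-one, `|·−1|² < |8|`, `a·a ≠ b·b`), `z = γ₂(γ_H)_w` norm-one with `z a², z b²` the roots of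
`χ_{g_w}`, GL literals `Γ_b = frameElt f b (a²) (b²)`, group literals `t_b` with one-place matrix `z·Γ_b` realising EXACTLY the norm pairs of `γ_H`, a slot `i` with the row's
antecedent `Δ‴(γ_H, t_b) = Δ‴(γ_H, t_0)·κ_i(b)`, a skew `δ ≠ 0`, and the depth token `|(z − z a a)(z − z b b)|_w = |ι_w ϖ_v|_w^m` — the product
`Δ‴_v[μ](γ_H, t_0) · C · (baseSign i · normSign σ (fPartProd δ (a,b,1) i)) · x` EQUALS `C · (q_v^m)⁻¹ · x` for every `C, x : ℂ` (on the row: `x = ampl q k B`).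
Assembly of: the slot lemma (S) (`i = 2`), ★ p854932 `finKappaAt_frame_eq` at `b = 0` (`κ_v(γ_H, t_0) = ω(−1) = baseSign 2`), and HEAD «Δ1» (`Δ‴ = ω(fPartProd)·q^{−m}·κ`):
the four signs pair off as two squares `ω(−1)² · ω(fPartProd)² = 1`.  What then remains of row (1) is the pure H-side identity
`Σ_s coef_s Φ^st(γ_H, hFamily s) = C · q_v^{−(n₁+n₂)∕2} · ampl(q, k, B)` — (b′) + arithmetic.
[cite: Rogawski1990, §4.9 p. 55; §4.3 (4.3.2) p. 43; Lemma 4.9.3 (4.9.2) p. 56] [cite: LabesseLanglands1979, §2 (2.1)–(2.2)] [cite: LanglandsShelstad1987, §3] -/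
theorem exists_nhds_one_forall_rowOne_rhs_collapse :
    ∃ V ∈ 𝓝 (1 : (cmDatum L 2 (Matrix.of fun i j : Fin 2 => if i.val + j.val + 1 = 2 then (1 : L) else 0)).Local v ×
        (cmDatum L 1 (Matrix.of fun i j : Fin 1 => if i.val + j.val + 1 = 1 then (1 : L) else 0)).Local v),
      ∀ γH ∈ V, IsLocalGRegular L v γH →
        ∀ (f : Fin 4 → Fin 3 → (Fin 3 → (w.1.adicCompletion L))), IsFourFrameFamily (galAdicCompletionMap (L := L) (IsCMField.complexConj L) hw) f →
        ∀ (δ a b z : w.1.adicCompletion L) (m : ℕ),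
        galAdicCompletionMap (L := L) (IsCMField.complexConj L) hw δ = -δ → δ ≠ 0 →
        a * galAdicCompletionMap (L := L) (IsCMField.complexConj L) hw a = 1 → b * galAdicCompletionMap (L := L) (IsCMField.complexConj L) hw b = 1 →
        z * galAdicCompletionMap (L := L) (IsCMField.complexConj L) hw z = 1 →
        Valued.v (a - 1) * Valued.v (a - 1) < Valued.v (8 : w.1.adicCompletion L) →
        Valued.v (b - 1) * Valued.v (b - 1) < Valued.v (8 : w.1.adicCompletion L) →
        a * a ≠ b * b →
        z = finGammaTwo L v γH w →
        ((((γH).1.val : GL (Fin 2) (UnitaryGroup.LocalRing L v)).val.map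
          (Pi.evalRingHom (fun w' : UnitaryGroup.PlacesOver L v => w'.1.adicCompletion L) w))).charpoly.IsRoot (z * (a * a)) →
        ((((γH).1.val : GL (Fin 2) (UnitaryGroup.LocalRing L v)).val.map
          (Pi.evalRingHom (fun w' : UnitaryGroup.PlacesOver L v => w'.1.adicCompletion L) w))).charpoly.IsRoot (z * (b * b)) →
        Valued.v ((z - z * (a * a)) * (z - z * (b * b))) =
          Valued.v ((toPlace v w (HeckeCharacter.uniformizer ↥(maximalRealSubfield L) v : v.adicCompletion ↥(maximalRealSubfield L))) ^ m) →
        ∀ (Γ : Fin 4 → GL (Fin 3) (w.1.adicCompletion L)),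
        (∀ b', (Γ b' : Matrix (Fin 3) (Fin 3) (w.1.adicCompletion L)) = frameElt (galAdicCompletionMap (L := L) (IsCMField.complexConj L) hw) f b' (a * a) (b * b)) →
        ∀ (tb : Fin 4 → ((UnitaryGroup.cmDatum L 3 (Matrix.of fun i j : Fin 3 => if i.val + j.val + 1 = 3 then (1 : L) else 0)).Local v)),
        (∀ b', ((((localNonsplitEquiv (IsCMField.complexConj L) (Matrix.of fun i j : Fin 3 => if i.val + j.val + 1 = 3 then (1 : L) else 0) (IsCMField.complexConj_ne_one L) w hw (tb b') :
              ↥(unitaryGroupOfForm (galAdicCompletionMap (L := L) (IsCMField.complexConj L) hw) (placeForm (Matrix.of fun i j : Fin 3 => if i.val + j.val + 1 = 3 then (1 : L) else 0) w.1))) :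
              GL (Fin 3) (w.1.adicCompletion L)) : Matrix (Fin 3) (Fin 3) (w.1.adicCompletion L))) = z • (Γ b' : Matrix (Fin 3) (Fin 3) (w.1.adicCompletion L))) →
        (∀ t' : ((UnitaryGroup.cmDatum L 3 (Matrix.of fun i j : Fin 3 => if i.val + j.val + 1 = 3 then (1 : L) else 0)).Local v),
          IsLocalNormPair L (Matrix.of fun i j : Fin 3 => if i.val + j.val + 1 = 3 then (1 : L) else 0) v γH t' ↔ ∃ b', ConjClasses.mk t' = ConjClasses.mk (tb b')) →
        ∀ (i : Fin 3),
        (∀ b' : Fin 4, ((finExplicitCollection L (Matrix.of fun i j : Fin 3 => if i.val + j.val + 1 = 3 then (1 : L) else 0) μ (finExplicitDelta_conj_left_all L (Matrix.of fun i j : Fin 3 => if i.val + j.val + 1 = 3 then (1 : L) else 0) μ) (finExplicitDelta_conj_right_all L (Matrix.of fun i j : Fin 3 => if i.val + j.val + 1 = 3 then (1 : L) else 0) μ)) v).Δ γH (tb b') = ((finExplicitCollection L (Matrix.of fun i j : Fin 3 => if i.val + j.val + 1 = 3 then (1 : L) else 0) μ (finExplicitDelta_conj_left_all L (Matrix.of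 fun i j : Fin 3 => if i.val + j.val + 1 = 3 then (1 : L) else 0) μ) (finExplicitDelta_conj_right_all L (Matrix.of fun i j : Fin 3 => if i.val + j.val + 1 = 3 then (1 : L) else 0) μ)) v).Δ γH (tb 0) * (kappaChar i b' : ℂ)) →
        ∀ (C x : ℂ),
          ((finExplicitCollection L (Matrix.of fun i j : Fin 3 => if i.val + j.val + 1 = 3 then (1 : L) else 0) μ (finExplicitDelta_conj_left_all L (Matrix.of fun i j : Fin 3 => if i.val + j.val + 1 = 3 then (1 : L) else 0) μ) (finExplicitDelta_conj_right_all L (Matrix.of fun i j : Fin 3 => if i.val + j.val + 1 = 3 then (1 : L) else 0) μ)) v).Δ γH (tb 0) * C *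
              (((baseSign (galAdicCompletionMap (L := L) (IsCMField.complexConj L) hw) i *
                  normSign (galAdicCompletionMap (L := L) (IsCMField.complexConj L) hw) (fPartProd δ ![a, b, 1] i) : ℤ) : ℂ) * x) =
            C * (((Nat.card (𝓞 ↥(maximalRealSubfield L) ⧸ v.asIdeal) : ℂ) ^ m))⁻¹ * x := by
  classical
  obtain ⟨V, hV, hΔ1⟩ := exists_nhds_one_forall_finExplicitDelta_eq_normSign_fPartProd_mul L v w hw μ hμω
    (Matrix.of fun i j : Fin 3 => if i.val + j.val + 1 = 3 then (1 : L) else 0)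
  refine ⟨V, hV, ?_⟩
  intro γH hγ hreg f hf δ a b z m hδ hδ0 ha hb hz1 ha8 hb8 hab hzγ hra hrb htok Γ hΓ tb htb hnorm i hrel C x
  set σ := galAdicCompletionMap (L := L) (IsCMField.complexConj L) hw with hσdef
  -- every literal is a norm pair of `γ_H`
  have hC : ∀ b', IsLocalNormPair L (Matrix.of fun i j : Fin 3 => if i.val + j.val + 1 = 3 then (1 : L) else 0) v γH (tb b') :=
    fun b' => (hnorm (tb b')).2 ⟨b', rfl⟩
  -- `z ≠ 0`, so the two roots are distinct
  have hz0 : z ≠ 0 := fun h => by rw [h, zero_mul] at hz1; exact zero_ne_one hz1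
  have hzab : z * (a * a) ≠ z * (b * b) := fun h => hab (mul_left_cancel₀ hz0 h)
  -- the base value (HEAD «Δ1») and the base sign `κ_v(γ_H, t_0) = ω(−1)` (★ p854932)
  have hbase := hΔ1 γH hγ δ a b z m (tb 0) hδ hδ0 ha hb ha8 hb8 hzγ hra hrb hzab htok (hC 0)
  have hκ0 := F0P3cDyRamTransferFactorTypeOne.finKappaAt_frame_eq L w hw γH hreg hf hzγ hΓ htb 0 (hC 0)
  have hsp0 : signPair 0 = (1, 1) := rfl
  rw [hsp0] at hκ0
  simp only [mul_one] at hκ0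
  -- the slot is `i = 2`
  have hu := isUnit_eval_finCharpolyTwo_of_isLocalGRegular L v γH hreg
  have hD0 : ((finExplicitCollection L (Matrix.of fun i j : Fin 3 => if i.val + j.val + 1 = 3 then (1 : L) else 0) μ
      (finExplicitDelta_conj_left_all L (Matrix.of fun i j : Fin 3 => if i.val + j.val + 1 = 3 then (1 : L) else 0) μ)
      (finExplicitDelta_conj_right_all L (Matrix.of fun i j : Fin 3 => if i.val + j.val + 1 = 3 then (1 : L) else 0) μ)) v).Δ γH (tb 0) ≠ 0 := by
    rw [finExplicitCollection_Δ]
    exact finExplicitDelta_ne_zero_of_isUnit L v _ γH (tb 0) μ (hC 0) hu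
  have hi : i = 2 := by
    refine slot_eq_two_of_kappaChar_eq hD0 fun b' => ?_
    rw [← hrel b']
    exact F0P3cDyRamTransferFactorTypeOne.delta_frame_eq_mul_kappaChar L w hw μ γH hreg hf hzγ hΓ htb hC b'
  subst hi
  -- collapse: `Δ‴(t_0) = ω(fPartProd)·q^{−m}·ω(−1)`, `baseSign 2 = ω(−1)`, squares of signs are `1`
  have hbS : baseSign σ (2 : Fin 3) = normSign σ (-1) := rfl
  have hsq1 : ((normSign σ (-1 : w.1.adicCompletion L) : ℤ) : ℂ) * ((normSign σ (-1 : w.1.adicCompletion L) : ℤ) : ℂ) = 1 := by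
    exact_mod_cast normSign_mul_self σ (-1 : w.1.adicCompletion L)
  have hsq2 : ((normSign σ (fPartProd δ ![a, b, 1] 2) : ℤ) : ℂ) * ((normSign σ (fPartProd δ ![a, b, 1] 2) : ℤ) : ℂ) = 1 := by
    exact_mod_cast normSign_mul_self σ (fPartProd δ ![a, b, 1] 2)
  rw [finExplicitCollection_Δ, hbase, hκ0, hbS]
  push_cast
  linear_combination (C * (((Nat.card (𝓞 ↥(maximalRealSubfield L) ⧸ v.asIdeal) : ℂ) ^ m))⁻¹ * x *
      (((normSign σ (fPartProd δ ![a, b, 1] 2) : ℤ) : ℂ) * ((normSign σ (fPartProd δ ![a, b, 1] 2) : ℤ) : ℂ))) * hsq1 +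
    (C * (((Nat.card (𝓞 ↥(maximalRealSubfield L) ⧸ v.asIdeal) : ℂ) ^ m))⁻¹ * x) * hsq2

end Collapse

end Summit.HodgeConjecture.HodgeConjecture.Cruxes.H413.F0P3cDyRamRowOneDeltaBaseValue

end
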